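import Mathlib

/-!
# Sign lemma for divergence-free drifts — the finite-dimensional calculus step

Helper file for the crux `MomentParity.QuarticGate` (stmt-AnomalousDissipation-11464), line
`recession-cone`, stub S1 (`stub_signLemma`). Pure Mathlib content, no fluid vocabulary:

* `hasFDerivAt_mvPolynomial_eval`, `contDiff_mvPolynomial_eval` — the evaluation map
  `y ↦ P(y)` of a real multivariate polynomial on `σ → ℝ` is smooth, with derivative
  `∑ᵢ ∂ᵢP(y) dyᵢ` (`MvPolynomial.pderiv`); the bridge between the algebraic `pderiv` of the crux
  statement and genuine derivatives.
* `exists_radial_bump` — a compactly supported `C¹` bump `ρ` with `ρ c₀ = 1` and RADIAL gradient.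
* `sum_fderiv_mul_eq_zero_of_div_free` — the Liouville/Gaussian SIGN LEMMA on `ℝ^ι`: if the
  `C¹` drift `V` is divergence free (`∑ₐ ∂ₐVₐ = 0`) and tangent to spheres (`∑ₐ cₐ Vₐ(c) = 0`), and
  the `C¹` observable `h` has `q := ∇h · V ≥ 0` everywhere, then `q ≡ 0`.
  Proof: integrate by parts coordinate by coordinate
  (`integral_mul_fderiv_eq_neg_fderiv_mul_of_integrable`):
  `∑ₐ ∫ (ρh) ∂ₐ(ρVₐ) = −∑ₐ ∫ ∂ₐ(ρh) (ρVₐ)`. The left integrand vanishes identically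
  (`div V = 0` and `∇ρ ∥ c ⊥ V`), the right one is `−ρ² q`; so `∫ ρ² q = 0` with `ρ² q ≥ 0`
  continuous, whence `q = 0` on `{ρ ≠ 0} ∋ c₀`.
-/

namespace Summit.AnomalousDissipation.AnomalousDissipation.Theorems.MomentParityQuarticGate

open MeasureTheory

set_option linter.dupNamespace false

/-! ## Polynomial maps are smooth; their derivative is `∑ᵢ ∂ᵢP dyᵢ` -/

/-- The evaluation map of a real multivariate polynomial in finitely many variables is
differentiable, with Fréchet derivative `∑ᵢ (∂ᵢP)(y) • dyᵢ` (`MvPolynomial.pderiv`). [folklore] -/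
theorem hasFDerivAt_mvPolynomial_eval {σ : Type*} [Fintype σ] [DecidableEq σ]
    (P : MvPolynomial σ ℝ) (y : σ → ℝ) :
    HasFDerivAt (fun y : σ → ℝ => MvPolynomial.eval y P)
      (∑ i, MvPolynomial.eval y (MvPolynomial.pderiv i P) •
        ContinuousLinearMap.proj (R := ℝ) (φ := fun _ : σ => ℝ) i) y := by
  induction P using MvPolynomial.induction_on with
  | C a =>
    simp only [MvPolynomial.eval_C, MvPolynomial.pderiv_C, map_zero, zero_smul,
      Finset.sum_const_zero]
    exact hasFDerivAt_const a y
  | add p q hp hq =>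
    simp only [map_add, add_smul, Finset.sum_add_distrib]
    exact hp.add hq
  | mul_X p n hp =>
    have key : ∀ i, MvPolynomial.eval y (MvPolynomial.pderiv i (p * MvPolynomial.X n)) =
        MvPolynomial.eval y (MvPolynomial.pderiv i p) * y n +
          (if i = n then MvPolynomial.eval y p else 0) := by
      intro i
      rw [MvPolynomial.pderiv_mul, map_add, map_mul, map_mul, MvPolynomial.eval_X]
      by_cases h : i = n
      · subst h
        rw [MvPolynomial.pderiv_X_self, map_one, mul_one, if_pos rfl]
      · rw [MvPolynomial.pderiv_X_of_ne (Ne.symm h), map_zero, mul_zero, if_neg h]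
    simp only [map_mul, MvPolynomial.eval_X]
    simp_rw [key, add_smul, Finset.sum_add_distrib, ite_smul, zero_smul, Finset.sum_ite_eq',
      Finset.mem_univ, if_true]
    refine (hp.mul (hasFDerivAt_apply (𝕜 := ℝ) n y)).congr_fderiv ?_
    rw [add_comm, Finset.smul_sum]
    congr 1
    refine Finset.sum_congr rfl fun i _ => ?_
    rw [smul_smul, mul_comm]

/-- The evaluation map of a real multivariate polynomial is `C^∞`. [folklore] -/
theorem contDiff_mvPolynomial_eval {σ : Type*} [Fintype σ] (P : MvPolynomial σ ℝ)
    {n : WithTop ℕ∞} : ContDiff ℝ n (fun y : σ → ℝ => MvPolynomial.eval y P) := by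
  induction P using MvPolynomial.induction_on with
  | C a =>
    simp only [MvPolynomial.eval_C]
    exact contDiff_const
  | add p q hp hq =>
    simp only [map_add]
    exact hp.add hq
  | mul_X p k hp =>
    simp only [map_mul, MvPolynomial.eval_X]
    exact hp.mul (contDiff_apply ℝ ℝ k)

/-! ## The sign lemma on `ℝ^ι` -/

/-- **A radial `C¹` bump adapted to a point.** For `c₀ ∈ ℝ^ι` there is a compactly supported `C¹`
function `ρ` with `ρ c₀ = 1` whose gradient is radial: `∂_b ρ(c) = D(c) c_b`
(`ρ(c) = ψ(|c₀|² + 1 − |c|²)`, `ψ = Real.smoothTransition`). [folklore] -/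
theorem exists_radial_bump {ι : Type*} [Fintype ι] [DecidableEq ι] (c₀ : ι → ℝ) :
    ∃ (ρ D : (ι → ℝ) → ℝ), ContDiff ℝ 1 ρ ∧ HasCompactSupport ρ ∧ ρ c₀ = 1 ∧
      ∀ c b, fderiv ℝ ρ c (Pi.single b 1) = D c * c b := by
  set R : ℝ := ∑ a, c₀ a * c₀ a with hR
  set σ : (ι → ℝ) → ℝ := fun c => ∑ a, c a * c a with hσ
  set σ' : (ι → ℝ) → ((ι → ℝ) →L[ℝ] ℝ) := fun c =>
    ∑ a, (c a • ContinuousLinearMap.proj (R := ℝ) (φ := fun _ : ι => ℝ) a +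
      c a • ContinuousLinearMap.proj (R := ℝ) (φ := fun _ : ι => ℝ) a) with hσ'
  have hσd : ∀ c, HasFDerivAt σ (σ' c) c := fun c =>
    HasFDerivAt.fun_sum fun a _ =>
      (hasFDerivAt_apply (𝕜 := ℝ) a c).mul (hasFDerivAt_apply (𝕜 := ℝ) a c)
  have hσC : ContDiff ℝ 1 σ :=
    ContDiff.sum fun a _ => (contDiff_apply ℝ ℝ a).mul (contDiff_apply ℝ ℝ a)
  have hσb : ∀ c b, σ' c (Pi.single b 1) = 2 * c b := by
    intro c b
    simp only [hσ', sum_apply, add_apply,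
      smul_apply, ContinuousLinearMap.proj_apply,
      Pi.single_apply, smul_eq_mul, mul_ite, mul_one, mul_zero, ← two_mul]
    rw [Finset.sum_ite_eq' Finset.univ b, if_pos (Finset.mem_univ b)]
  refine ⟨fun c => Real.smoothTransition (R + 1 - σ c),
    fun c => -(2 * deriv Real.smoothTransition (R + 1 - σ c)), ?_, ?_, ?_, ?_⟩
  · exact Real.smoothTransition.contDiff.comp (contDiff_const.sub hσC)
  · refine HasCompactSupport.intro (K := {c | σ c ≤ R + 1}) ?_ ?_
    · refine Metric.isCompact_of_isClosed_isBounded (isClosed_le hσC.continuous continuous_const) ?_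
      refine (Metric.isBounded_iff_subset_closedBall 0).2 ⟨Real.sqrt (R + 1), fun c hc => ?_⟩
      rw [mem_closedBall_zero_iff, pi_norm_le_iff_of_nonneg (Real.sqrt_nonneg _)]
      intro b
      rw [Real.norm_eq_abs]
      refine Real.abs_le_sqrt ?_
      calc c b ^ 2 = c b * c b := sq _
        _ ≤ σ c := Finset.single_le_sum (f := fun a => c a * c a) (fun a _ => mul_self_nonneg _)
            (Finset.mem_univ b)
        _ ≤ R + 1 := hc
    · intro c hc
      simp only [Set.mem_setOf_eq, not_le] at hc
      exact Real.smoothTransition.zero_of_nonpos (by linarith)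
  · change Real.smoothTransition (R + 1 - ∑ a, c₀ a * c₀ a) = 1
    rw [← hR, add_sub_cancel_left]
    exact Real.smoothTransition.one_of_one_le le_rfl
  · intro c b
    have hST : HasDerivAt Real.smoothTransition
        (deriv Real.smoothTransition (R + 1 - σ c)) (R + 1 - σ c) :=
      ((Real.smoothTransition.contDiff (n := 1)).differentiable one_ne_zero _).hasDerivAt
    have h1 := hST.comp_hasFDerivAt c ((hasFDerivAt_const (R + 1) c).sub (hσd c))
    have h : HasFDerivAt (fun c => Real.smoothTransition (R + 1 - σ c))
        (deriv Real.smoothTransition (R + 1 - σ c) • ((0 : (ι → ℝ) →L[ℝ] ℝ) - σ' c)) c := h1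
    rw [h.fderiv, smul_apply, sub_apply,
      zero_apply, hσb, smul_eq_mul]
    ring

/-- **Sign lemma (Liouville/Gaussian).** On `ℝ^ι`, let `h` be `C¹` and `V = (Vₐ)` a `C¹`
drift which is divergence free, `∑ₐ ∂ₐVₐ ≡ 0`, and tangent to spheres, `∑ₐ cₐ Vₐ(c) = 0`.
If `q(c) := ∑ₐ ∂ₐh(c) Vₐ(c) ≥ 0` everywhere then `q ≡ 0`: for a radial compactly supported bump
`ρ`, `∫ ρ² q = −∑ₐ ∫ (ρh) ∂ₐ(ρ Vₐ) = 0` by integration by parts, and `ρ²q ≥ 0` is continuous.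
[folklore] -/
theorem sum_fderiv_mul_eq_zero_of_div_free {ι : Type*} [Fintype ι] [DecidableEq ι]
    {h : (ι → ℝ) → ℝ} {V : ι → (ι → ℝ) → ℝ}
    (hh : ContDiff ℝ 1 h) (hV : ∀ a, ContDiff ℝ 1 (V a))
    (hdiv : ∀ c, ∑ a, fderiv ℝ (V a) c (Pi.single a 1) = 0)
    (htan : ∀ c : ι → ℝ, ∑ a, c a * V a c = 0)
    (hpos : ∀ c, 0 ≤ ∑ a, fderiv ℝ h c (Pi.single a 1) * V a c) (c₀ : ι → ℝ) :
    ∑ a, fderiv ℝ h c₀ (Pi.single a 1) * V a c₀ = 0 := by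
  obtain ⟨ρ, D, hρC, hρsupp, hρ0, hρd⟩ := exists_radial_bump c₀
  set q : (ι → ℝ) → ℝ := fun c => ∑ a, fderiv ℝ h c (Pi.single a 1) * V a c with hq
  have hcd : ∀ {f : (ι → ℝ) → ℝ}, ContDiff ℝ 1 f → ∀ v, Continuous fun c => fderiv ℝ f c v :=
    fun hf v => (hf.continuous_fderiv one_ne_zero).clm_apply continuous_const
  have hqc : Continuous q := continuous_finsetSum _ fun a _ => (hcd hh _).mul (hV a).continuous
  have hF : ContDiff ℝ 1 fun c => ρ c * h c := hρC.mul hh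
  have hG : ∀ a, ContDiff ℝ 1 fun c => ρ c * V a c := fun a => hρC.mul (hV a)
  have hFsupp : HasCompactSupport fun c => ρ c * h c := hρsupp.mul_right
  have hGsupp : ∀ a, HasCompactSupport fun c => ρ c * V a c := fun a => hρsupp.mul_right
  have hi1 : ∀ a, Integrable (fun c => fderiv ℝ (fun c => ρ c * h c) c (Pi.single a 1) *
      (ρ c * V a c)) := fun a =>
    ((hcd hF _).mul (hG a).continuous).integrable_of_hasCompactSupport (hGsupp a).mul_left
  have hi2 : ∀ a, Integrable (fun c => (ρ c * h c) *
      fderiv ℝ (fun c => ρ c * V a c) c (Pi.single a 1)) := fun a =>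
    (hF.continuous.mul (hcd (hG a) _)).integrable_of_hasCompactSupport hFsupp.mul_right
  -- integration by parts, coordinate by coordinate
  have ibp : ∀ a, ∫ c, (ρ c * h c) * fderiv ℝ (fun c => ρ c * V a c) c (Pi.single a 1) =
      -∫ c, fderiv ℝ (fun c => ρ c * h c) c (Pi.single a 1) * (ρ c * V a c) := fun a =>
    integral_mul_fderiv_eq_neg_fderiv_mul_of_integrable (hi1 a) (hi2 a)
      ((hF.continuous.mul (hG a).continuous).integrable_of_hasCompactSupport hFsupp.mul_right)
      (fun c _ => hF.differentiable one_ne_zero c) (fun c _ => (hG a).differentiable one_ne_zero c)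
  -- pointwise: the derivatives of the products
  have hρdiff : ∀ c, DifferentiableAt ℝ ρ c := fun c => hρC.differentiable one_ne_zero c
  have dG : ∀ a c, fderiv ℝ (fun c => ρ c * V a c) c (Pi.single a 1) =
      ρ c * fderiv ℝ (V a) c (Pi.single a 1) + V a c * (D c * c a) := by
    intro a c
    rw [fderiv_fun_mul (hρdiff c) ((hV a).differentiable one_ne_zero c), add_apply,
      smul_apply, smul_apply, hρd, smul_eq_mul, smul_eq_mul]
  have dF : ∀ a c, fderiv ℝ (fun c => ρ c * h c) c (Pi.single a 1) =
      ρ c * fderiv ℝ h c (Pi.single a 1) + h c * (D c * c a) := by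
    intro a c
    rw [fderiv_fun_mul (hρdiff c) (hh.differentiable one_ne_zero c), add_apply,
      smul_apply, smul_apply, hρd, smul_eq_mul, smul_eq_mul]
  -- the left integrand vanishes identically, the right one is `ρ² q`
  have hL : ∀ c, ∑ a, (ρ c * h c) * fderiv ℝ (fun c => ρ c * V a c) c (Pi.single a 1) = 0 := by
    intro c
    simp_rw [dG]
    have h1 : ∑ a, (ρ c * h c) * (ρ c * fderiv ℝ (V a) c (Pi.single a 1) + V a c * (D c * c a)) =
        (ρ c * h c * ρ c) * ∑ a, fderiv ℝ (V a) c (Pi.single a 1) +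
          (ρ c * h c * D c) * ∑ a, c a * V a c := by
      rw [Finset.mul_sum, Finset.mul_sum, ← Finset.sum_add_distrib]
      exact Finset.sum_congr rfl fun a _ => by ring
    rw [h1, hdiv c, htan c, mul_zero, mul_zero, add_zero]
  have hRt : ∀ c, ∑ a, fderiv ℝ (fun c => ρ c * h c) c (Pi.single a 1) * (ρ c * V a c) =
      ρ c ^ 2 * q c := by
    intro c
    simp_rw [dF]
    have h1 : ∑ a, (ρ c * fderiv ℝ h c (Pi.single a 1) + h c * (D c * c a)) * (ρ c * V a c) =
        ρ c ^ 2 * q c + (h c * D c * ρ c) * ∑ a, c a * V a c := by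
      rw [hq, Finset.mul_sum, Finset.mul_sum, ← Finset.sum_add_distrib]
      exact Finset.sum_congr rfl fun a _ => by ring
    rw [h1, htan c, mul_zero, add_zero]
  -- sum the integrations by parts: `∫ ρ² q = 0`
  have hint0 : ∫ c, ρ c ^ 2 * q c = 0 := by
    have hs := Finset.sum_congr rfl fun a (_ : a ∈ (Finset.univ : Finset ι)) => ibp a
    rw [← integral_finsetSum _ fun a _ => hi2 a, Finset.sum_neg_distrib,
      ← integral_finsetSum _ fun a _ => hi1 a] at hs
    simp_rw [hL, hRt, integral_zero] at hs
    linarith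
  -- a nonnegative continuous integrable function with zero integral vanishes
  have hnn : 0 ≤ fun c => ρ c ^ 2 * q c := fun c => mul_nonneg (sq_nonneg _) (hpos c)
  have hcont : Continuous fun c => ρ c ^ 2 * q c := (hρC.continuous.pow 2).mul hqc
  have hsupp2 : HasCompactSupport fun c => ρ c ^ 2 * q c := by
    have e : (fun c => ρ c ^ 2 * q c) = fun c => ρ c * (ρ c * q c) := funext fun c => by ring
    rw [e]
    exact hρsupp.mul_right
  have hae : (fun c => ρ c ^ 2 * q c) =ᵐ[volume] 0 :=
    (integral_eq_zero_iff_of_nonneg hnn (hcont.integrable_of_hasCompactSupport hsupp2)).1 hint0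
  have hzero : (fun c => ρ c ^ 2 * q c) = 0 :=
    (Continuous.ae_eq_iff_eq volume hcont continuous_const).1 hae
  have h0 := congr_fun hzero c₀
  simp only [hρ0, one_pow, one_mul, Pi.zero_apply] at h0
  exact h0

/-- **Sign lemma, registered form** (sub-goal of stub S1 `stub_signLemma` of the crux
`MomentParity.QuarticGate`, line `recession-cone`): `∇h · V ≥ 0` with `V` a `C¹` divergence-free
drift tangent to spheres forces `∇h · V ≡ 0` on `ℝ^ι`. [folklore] -/
theorem signLemma_calculus :
    ∀ {ι : Type} [Fintype ι] [DecidableEq ι] {h : (ι → ℝ) → ℝ} {V : ι → (ι → ℝ) → ℝ},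
      ContDiff ℝ 1 h → (∀ a, ContDiff ℝ 1 (V a)) →
      (∀ c, ∑ a, fderiv ℝ (V a) c (Pi.single a 1) = 0) →
      (∀ c : ι → ℝ, ∑ a, c a * V a c = 0) →
      (∀ c, 0 ≤ ∑ a, fderiv ℝ h c (Pi.single a 1) * V a c) →
      ∀ c₀ : ι → ℝ, ∑ a, fderiv ℝ h c₀ (Pi.single a 1) * V a c₀ = 0 :=
  fun hh hV hdiv htan hpos c₀ => sum_fderiv_mul_eq_zero_of_div_free hh hV hdiv htan hpos c₀

end Summit.AnomalousDissipation.AnomalousDissipation.Theorems.MomentParityQuarticGate
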